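/-
Copyright (c) 2026 the pub-hodgecm-mathlib formalisation cell (harness21).  Prover seat hodgecm-mathlib-LH4-p07 (g9), req620 Track A «(D-RAM) FOUR-FRAME» squad
(STAGE-1b, heir dealer∕pen LH4-plan (g13) WORD #51 (1): NAMED «(T5-P-axis)», D-1b draft v2 §3 «counting producers»; row-(2) lineage LH4-p07), 2026-09-04.
-/
import Summits.HodgeConjecture.HodgeConjecture.Theorems.F0P3cDyRamJointProfileCensusAxisTables     -- ★ p859438 (LH4-p07 (g8)): FILE 1 — §1 collapse `sum_ite_isOrd₃_eq_sum_range`, §2 per-type a = 0 tables summed; brings ★ p859363, ★ (α), the ★ `_of_frame` ∕ `hnP∕hnM` tables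
import HarnessLib

/-!
# Crux `H413`, line LH4 «(D-RAM) FOUR-FRAME» — STAGE-1b, row (2): (T5-P-axis) FILE 2 «THE AXIS TERM OF THE `lev_{a,m}` CENSUS IN CLOSED FORM, PER THIRD-FIELD TYPE»
# `AX(lev_{a,m}) = Σ_{j ≤ J′} row⁰_type(j)`,  `J′ = min(jλ − a, jλ + n − b)`;  type RamK: `AX = Σ_{i ≤ J′∕2} q^i + Σ_{d ≤ i ≤ J′∕2} q^i` (hyperbolic), `= Σ_{i < min(J′∕2+1, d)} q^i` (anisotropic), `= Σ_{i ≤ J′∕2} q^i` below the threshold `J′ + 2 ≤ 2d` (EITHER side)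

Cell `hodgecm-mathlib` (D-0151), FLOOR 0, crux item H413 = `stmt-HodgeConjecture-24833`, route of record `HCCMUnconditional`; squad F0∕P3c∕LH4; lane
`--supports stmt-HodgeConjecture-24833 --as helper` (count-neutral; pays NO tier-0 row).  THEOREMS ONLY (no `def`, no instance, no notation, no `sorry`, default heartbeats).
NAMED by heir dealer LH4-plan (g13) WORD #51 (1) as «(T5-P-axis)» (D-1b draft v2 5bf49cb6 §3: counting producer below the `stub_hside_levLo∕levHi` row); SIG sheet
`F0/P3c/LH4/LH4-p07/g8/SIG-T5P-axis.v1.LH4p07g8.md` (53788de8) §3–§4 — this is the sequel announced in ★ p859438's docstring.  Consumers: the directive's (C2) template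
instances (pieces `sq_{m*}`, `lev_{ℓ₀+1,m*}`, `lev_{ℓ₀,m_c}`, `lev_{ℓ₀+1,m_c}`; LH4-p04 (g7) ★ p859421 (C2-lev-m_c) at the CM place) and the row-(2) letter `hG₂` of LH4-p06 (g6)'s
(H-lev) assembly `hSideLevels_hFamily_of_rows`.

THE OBJECT.  The AXIS TERM of the row-(2) census of a template piece `lev_{a,m}` (★ p859229 `ncard_fixed_selfDual_endoGL_lev_sq_eq_orderForm`) is
`AX = Σ_{j ∈ range (J+1)} [IsOrd_j lam ∧ IsOrd_j (c⁻¹(lam − 1)) ∧ IsOrd_j (c′⁻¹(lam − 1)²)]·#levelSet(j, 0)`.  ★ p859438 FILE 1 proved (§1) that the three-clause indicator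
TRUNCATES the sum at `J′ := min(jλ − a, jλ + n − b)` for any summand, and (§2) summed the a = 0 rows of the ★ level tables per third-field type and side.  THIS FILE composes
the two and evaluates type RamK in closed form:
* §0 ARITHMETIC (type-free, over `ℕ`): the parity re-indexing `Σ_{j ≤ N} [j even]·f(j∕2) = Σ_{i ≤ N∕2} f i` (`sum_range_succ_ite_even`); the RamK a = 0 rows summed in closed
  form for every `d ≥ 1` — hyperbolic `Σ_{j ≤ N} row⁰ = Σ_{i ≤ N∕2} q^i + Σ_{i ∈ Ico d (N∕2+1)} q^i` (`sum_ramK_hyper_rowZero_eq`), anisotropic `= Σ_{i < min(N∕2+1, d)} q^i`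
  (`sum_ramK_aniso_rowZero_eq`), and BELOW THE THRESHOLD `N + 2 ≤ 2d` both `= Σ_{i ≤ N∕2} q^i` (`…_of_le`); the geometric evaluation `(Σ_{i<m} q^i)(q − 1) + 1 = q^m` in `ℕ`
  (`geom_sum_mul_sub_one_add_one`, Mathlib `geom_sum_mul_add`).
* §1 COMPOSED (FILE 1 §1 ∘ §2), one theorem per type and side, hypothesis block = the cited ★ table package VERBATIM followed by FILE 1's §1 tokens (`ρα ≠ α`, `ϖE ≠ 0`,
  `|ϖE| < 1` are READ OFF the package — `|α − ρα| = 1` resp. the datum, `|ϖE| = exp(−1)` resp. `exp(−2)` — and dropped): `axis_lev_eq_sum_table_ramK_hyper ∕ _ramK_aniso ∕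
  _unr_hyper ∕ _unr_aniso ∕ _ramM_hnP ∕ _ramM_hnM : AX = Σ_{j ∈ range (J′+1)} row⁰_type(j)`.
* §2 TYPE RamK IN CLOSED FORM (§1 ∘ §0; `1 ≤ d` is a clause of the datum): `axis_lev_eq_geom_ramK_hyper : AX = Σ_{i ∈ range (J′∕2+1)} q^i + Σ_{i ∈ Ico d (J′∕2+1)} q^i`,
  `axis_lev_eq_geom_ramK_aniso : AX = Σ_{i ∈ range (min (J′∕2+1) d)} q^i`, and the SIDE-FREE statement below the threshold
  `axis_lev_eq_geom_ramK_of_le (hJd : J′ + 2 ≤ 2d) : AX = Σ_{i ∈ range (J′∕2+1)} q^i` (no `hhyper`∕`haniso` letter: the two sides agree there).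
READING.  Below the threshold the `lev_{a,m}` axis at type RamK is the vertex count of a ball of radius `J′∕2` about the root ray of the apartment (`1 + q + ⋯ + q^{J′∕2}`); above it the
hyperbolic side doubles the levels `i ≥ d` and the anisotropic side stops at `i = d − 1` — the standard tree picture of [Kottwitz1986BaseChangeUnits, §1] read through the ★ tables.
The types U and RamM stay in TABLE form here (their `d`-parity ∕ `s0`-window structure is consumed row-wise by the (C2) instances; a closed form is typed on demand).
HONEST LABEL.  Count-neutral arithmetic over ★ organs; nothing printed is asserted; no census law is stated; `HC_CM` is proved only modulo the 7 printed citations (2 remaining named inputs: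
hLiu418 = `stmt-HodgeConjecture-24832`, h413 = `stmt-HodgeConjecture-24833`) until rung 0 closes.

## References
* [Kottwitz1986BaseChangeUnits] R. E. Kottwitz, *Base change for unit elements of Hecke algebras*, Compositio Math. 60 (1986): §1 pp. 240–241.
* [Flicker1998UnitaryFL] Y. Z. Flicker, *Elementary proof of the fundamental lemma for a unitary group*, Canad. J. Math. 50 (1998): Prop. 7 p. 84 (the level tables).
* [Jacobowitz1962] R. Jacobowitz, *Hermitian forms over local fields*, Amer. J. Math. 84 (1962): §4, §7.
* [Serre1979] J.-P. Serre, *Local Fields*, GTM 67 (1979): Ch. III §6 Prop. 12; Ch. V §1–§3.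
* [Serre1980Trees] J.-P. Serre, *Trees*, Springer (1980): Ch. II §1.1 (balls in the tree of a local field).
-/

set_option autoImplicit false

open WithZero IsLocalRing
open scoped Valued
open Literature.NumberTheory.Automorphic.UnitaryThreeFourFrame (IsRamifiedQuadraticDatum)
open Summit.HodgeConjecture.HodgeConjecture.Cruxes.H413.F0P3cDyRamToricCensusDefs
open Summit.HodgeConjecture.HodgeConjecture.Cruxes.H413.F0P3cDyRamOrderFiltrationRange
open Summit.HodgeConjecture.HodgeConjecture.Cruxes.H413.F0P3cDyRamToricLevelCensusRamM (map_ne_self_of_datum)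
open Summit.HodgeConjecture.HodgeConjecture.Cruxes.H413.F0P3cDyRamJointProfileCensusAxisTables

namespace Summit.HodgeConjecture.HodgeConjecture.Cruxes.H413.F0P3cDyRamJointProfileCensusAxisClosedForm

/-! ## §0 Arithmetic: parity re-indexing; the RamK a = 0 rows summed in closed form; the geometric evaluation -/

/-- **PARITY RE-INDEXING**: `Σ_{j ≤ N} [j even]·f(j∕2) = Σ_{i ≤ N∕2} f i` (any additive commutative monoid). [cite: Serre1980Trees, Ch. II §1.1] -/
theorem sum_range_succ_ite_even {N : Type*} [AddCommMonoid N] (f : ℕ → N) (n : ℕ) :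
    ∑ j ∈ Finset.range (n + 1), (if j % 2 = 0 then f (j / 2) else 0) = ∑ i ∈ Finset.range (n / 2 + 1), f i := by
  induction n with
  | zero => simp
  | succ n ih =>
    rw [Finset.sum_range_succ, ih]
    rcases Nat.even_or_odd n with ⟨k, hk⟩ | ⟨k, hk⟩
    · have h1 : ¬ (n + 1) % 2 = 0 := by omega
      have h2 : (n + 1) / 2 = n / 2 := by omega
      rw [if_neg h1, add_zero, h2]
    · have h1 : (n + 1) % 2 = 0 := by omega
      have h2 : (n + 1) / 2 = n / 2 + 1 := by omega
      rw [if_pos h1, h2, Finset.sum_range_succ f (n / 2 + 1)]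

/-- **THE RamK HYPERBOLIC a = 0 ROW SUMMED, CLOSED FORM** (`d ≥ 1`): `Σ_{j ≤ N} ([j = 0] + [j ≥ 2 even]·(2 if 2d ≤ j+1 else 1)·q^{j∕2}) = Σ_{i ≤ N∕2} q^i + Σ_{i ∈ Ico d (N∕2+1)} q^i`
— the levels `i ≥ d` are counted twice. [cite: Flicker1998UnitaryFL, Prop. 7 p. 84] [cite: Serre1980Trees, Ch. II §1.1] -/
theorem sum_ramK_hyper_rowZero_eq (q n : ℕ) {d : ℕ} (hd : 1 ≤ d) :
    ∑ j ∈ Finset.range (n + 1), (if j = 0 then 1 else if j % 2 = 1 then 0 else (if 2 * d ≤ j + 1 then 2 else 1) * q ^ (j / 2)) =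
      ∑ i ∈ Finset.range (n / 2 + 1), q ^ i + ∑ i ∈ Finset.Ico d (n / 2 + 1), q ^ i := by
  have hpt : ∀ j, (if j = 0 then 1 else if j % 2 = 1 then 0 else (if 2 * d ≤ j + 1 then 2 else 1) * q ^ (j / 2)) =
      if j % 2 = 0 then (q ^ (j / 2) + if d ≤ j / 2 then q ^ (j / 2) else 0) else 0 := by
    intro j
    by_cases hj0 : j = 0
    · subst hj0
      have : ¬ d ≤ 0 := by omega
      simp [this]
    · by_cases hpar : j % 2 = 1
      · simp [hj0, hpar]
      · have hpar0 : j % 2 = 0 := by omega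
        by_cases hdj : 2 * d ≤ j + 1
        · have : d ≤ j / 2 := by omega
          simp [hj0, hpar0, hdj, this]; ring
        · have : ¬ d ≤ j / 2 := by omega
          simp [hj0, hpar0, hdj, this]
  rw [Finset.sum_congr rfl fun j _ => hpt j, sum_range_succ_ite_even (fun i => q ^ i + if d ≤ i then q ^ i else 0) n,
    Finset.sum_add_distrib, ← Finset.sum_filter, Finset.range_eq_Ico, Finset.Ico_filter_le]
  simp

/-- **THE RamK ANISOTROPIC a = 0 ROW SUMMED, CLOSED FORM** (`d ≥ 1`): `Σ_{j ≤ N} ([j = 0] + [j ≥ 2 even, j + 2 ≤ 2d]·q^{j∕2}) = Σ_{i < min(N∕2+1, d)} q^i`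
— the levels stop at `i = d − 1`. [cite: Flicker1998UnitaryFL, Prop. 7 p. 84] [cite: Serre1980Trees, Ch. II §1.1] -/
theorem sum_ramK_aniso_rowZero_eq (q n : ℕ) {d : ℕ} (hd : 1 ≤ d) :
    ∑ j ∈ Finset.range (n + 1), (if j = 0 then 1 else if j % 2 = 1 then 0 else if j + 2 ≤ 2 * d then q ^ (j / 2) else 0) =
      ∑ i ∈ Finset.range (min (n / 2 + 1) d), q ^ i := by
  have hpt : ∀ j, (if j = 0 then 1 else if j % 2 = 1 then 0 else if j + 2 ≤ 2 * d then q ^ (j / 2) else 0) =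
      if j % 2 = 0 then (if j / 2 < d then q ^ (j / 2) else 0) else 0 := by
    intro j
    by_cases hj0 : j = 0
    · subst hj0
      have : 0 < d := by omega
      simp [this]
    · by_cases hpar : j % 2 = 1
      · simp [hj0, hpar]
      · have hpar0 : j % 2 = 0 := by omega
        by_cases hdj : j + 2 ≤ 2 * d
        · have : j / 2 < d := by omega
          simp [hj0, hpar0, hdj, this]
        · have : ¬ j / 2 < d := by omega
          simp [hj0, hpar0, hdj, this]
  rw [Finset.sum_congr rfl fun j _ => hpt j, sum_range_succ_ite_even (fun i => if i < d then q ^ i else 0) n,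
    ← Finset.sum_filter, Finset.range_eq_Ico, Finset.Ico_filter_lt, ← Finset.range_eq_Ico]

/-- **BELOW THE THRESHOLD `N + 2 ≤ 2d`, HYPERBOLIC**: the doubled levels are absent, `Σ_{j ≤ N} row⁰ = Σ_{i ≤ N∕2} q^i`. [cite: Flicker1998UnitaryFL, Prop. 7 p. 84] -/
theorem sum_ramK_hyper_rowZero_eq_of_le (q n : ℕ) {d : ℕ} (h : n + 2 ≤ 2 * d) :
    ∑ j ∈ Finset.range (n + 1), (if j = 0 then 1 else if j % 2 = 1 then 0 else (if 2 * d ≤ j + 1 then 2 else 1) * q ^ (j / 2)) =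
      ∑ i ∈ Finset.range (n / 2 + 1), q ^ i := by
  rw [sum_ramK_hyper_rowZero_eq q n (show 1 ≤ d by omega), Finset.Ico_eq_empty_of_le (show n / 2 + 1 ≤ d by omega),
    Finset.sum_empty, add_zero]

/-- **BELOW THE THRESHOLD `N + 2 ≤ 2d`, ANISOTROPIC**: the cut at `d − 1` is idle, `Σ_{j ≤ N} row⁰ = Σ_{i ≤ N∕2} q^i` — the SAME value as the hyperbolic side.
[cite: Flicker1998UnitaryFL, Prop. 7 p. 84] -/
theorem sum_ramK_aniso_rowZero_eq_of_le (q n : ℕ) {d : ℕ} (h : n + 2 ≤ 2 * d) :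
    ∑ j ∈ Finset.range (n + 1), (if j = 0 then 1 else if j % 2 = 1 then 0 else if j + 2 ≤ 2 * d then q ^ (j / 2) else 0) =
      ∑ i ∈ Finset.range (n / 2 + 1), q ^ i := by
  rw [sum_ramK_aniso_rowZero_eq q n (show 1 ≤ d by omega), min_eq_left (show n / 2 + 1 ≤ d by omega)]

/-- **GEOMETRIC EVALUATION IN `ℕ`** (no truncated subtraction on the right): `(Σ_{i<m} q^i)·(q − 1) + 1 = q^m` for `q ≥ 1` (Mathlib `geom_sum_mul_add` at `x := q − 1`).
[cite: Serre1980Trees, Ch. II §1.1] -/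
theorem geom_sum_mul_sub_one_add_one {q : ℕ} (hq : 1 ≤ q) (m : ℕ) :
    (∑ i ∈ Finset.range m, q ^ i) * (q - 1) + 1 = q ^ m := by
  have h := geom_sum_mul_add (q - 1) m
  rwa [Nat.sub_add_cancel hq] at h

/-! ## §1 Composed: the axis term equals the a = 0 table summed to `J′`, per third-field type and side (FILE 1 §1 ∘ §2) -/

variable {K : Type} [Field K] [Valued K ℤᵐ⁰] {ρ Θ : K →+* K} {α ϖE h : K}

/-- `|α − ρα| = 1 ⇒ ρα ≠ α`. [cite: Serre1979, Ch. III §6 Prop. 12] -/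
theorem map_ne_self_of_v_sub_map_eq_one (hα : Valued.v (α - ρ α) = 1) : ρ α ≠ α := fun hρα => by
  rw [hρα, sub_self, map_zero] at hα
  exact zero_ne_one hα

/-- `|ϖE| = exp(−e)`, `e ≥ 1` ⇒ `ϖE ≠ 0` and `|ϖE| < 1`. [cite: Serre1979, Ch. III §6 Prop. 12] -/
theorem ne_zero_and_v_lt_one_of_v_eq_exp_neg {e : ℤ} (he : 1 ≤ e) (hϖ : Valued.v ϖE = exp (-e)) : ϖE ≠ 0 ∧ Valued.v ϖE < 1 := by
  refine ⟨fun h0 => ?_, ?_⟩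
  · rw [h0, map_zero] at hϖ
    exact (exp_ne_zero hϖ.symm).elim
  · rw [hϖ, ← exp_zero, exp_lt_exp]
    omega

open scoped Classical in
/-- **(T5-P-axis) COMPOSED, TYPE RamK, HYPERBOLIC SIDE**: `AX = Σ_{j ∈ range (J′+1)} ([j = 0] + [j ≥ 2 even]·(2 if 2d ≤ j+1 else 1)·q^{j∕2})`, `J′ = min(jλ − a, jλ + n − b)`.
Package of ★ `ncard_levelSet_ramK_hyper_of_frame` VERBATIM, then FILE 1's §1 tokens. [cite: Kottwitz1986BaseChangeUnits, §1 pp. 240–241] [cite: Flicker1998UnitaryFL, Prop. 7 p. 84] -/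
theorem axis_lev_eq_sum_table_ramK_hyper [CompleteSpace K] [IsDiscreteValuationRing 𝒪[K]] [Finite 𝓀[K]]
    (hρρ : ∀ x, ρ (ρ x) = x) (hvρ : ∀ x, Valued.v (ρ x) = Valued.v x) (hΘρ : ∀ x, Θ (ρ x) = ρ (Θ x))
    (hα1 : Valued.v α ≤ 1) (hα : Valued.v (α - ρ α) = 1) {d t : ℕ} (hD : IsRamifiedQuadraticDatum Θ ϖE d t) (hρϖ : ρ ϖE = ϖE)
    (hΘh : Θ h = h) (hh : h ≠ 0) {q : ℕ} (hq : Nat.card 𝓀[K] = q ^ 2)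
    (hσres : ∀ z : K, ρ z = z → Valued.v z ≤ 1 → Valued.v (Θ z - z) < 1) (hram : Valued.v (α - Θ α) < 1)
    (hhyper : ∃ x : K, x ≠ 0 ∧ h * Θ x * x + ρ (h * Θ x * x) = 0)
    {lam : K} (hlam1 : Valued.v lam ≤ 1) {jl : ℕ} (hjl : Valued.v (lam - ρ lam) = Valued.v ϖE ^ jl * Valued.v (α - ρ α))
    {c : K} (hρc : ρ c = c) {a : ℕ} (hc : Valued.v c = Valued.v ϖE ^ a) (hlev : Valued.v (lam - 1) ≤ Valued.v c) (hajl : a ≤ jl)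
    {c' : K} (hρc' : ρ c' = c') {b : ℕ} (hc' : Valued.v c' = Valued.v ϖE ^ b) (hlev2 : Valued.v ((lam - 1) * (lam - 1)) ≤ Valued.v c')
    {n : ℕ} (hn : Valued.v (lam + ρ lam - 2) = Valued.v ϖE ^ n) (hb : b ≤ jl + n) {J : ℕ} (hJ : jl ≤ J) :
    ∑ j ∈ Finset.range (J + 1),
        (if IsOrd ρ α (ϖE ^ j) lam ∧ IsOrd ρ α (ϖE ^ j) (c⁻¹ * (lam - 1)) ∧ IsOrd ρ α (ϖE ^ j) (c'⁻¹ * ((lam - 1) * (lam - 1))) then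
          (levelSet ρ Θ α ϖE h j 0).ncard else 0) =
      ∑ j ∈ Finset.range (min (jl - a) (jl + n - b) + 1), (if j = 0 then 1 else if j % 2 = 1 then 0 else (if 2 * d ≤ j + 1 then 2 else 1) * q ^ (j / 2)) := by
  obtain ⟨hϖ0, hϖ1⟩ := ne_zero_and_v_lt_one_of_v_eq_exp_neg le_rfl hD.2.2.1
  rw [sum_ite_isOrd₃_eq_sum_range (map_ne_self_of_v_sub_map_eq_one hα) hϖ0 hϖ1 hlam1 hjl hρc hc hlev hajl hρc' hc' hlev2 hn hb hJ,
    sum_ncard_levelSet_zero_eq_ramK_hyper hρρ hvρ hΘρ hα1 hα hD hρϖ hΘh hh hq hσres hram hhyper]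

open scoped Classical in
/-- **(T5-P-axis) COMPOSED, TYPE RamK, ANISOTROPIC SIDE**: `AX = Σ_{j ∈ range (J′+1)} ([j = 0] + [j ≥ 2 even, j + 2 ≤ 2d]·q^{j∕2})`.
Package of ★ `ncard_levelSet_ramK_aniso_of_frame` VERBATIM, then FILE 1's §1 tokens. [cite: Kottwitz1986BaseChangeUnits, §1 pp. 240–241] [cite: Flicker1998UnitaryFL, Prop. 7 p. 84] -/
theorem axis_lev_eq_sum_table_ramK_aniso [CompleteSpace K] [IsDiscreteValuationRing 𝒪[K]] [Finite 𝓀[K]]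
    (hρρ : ∀ x, ρ (ρ x) = x) (hvρ : ∀ x, Valued.v (ρ x) = Valued.v x) (hΘρ : ∀ x, Θ (ρ x) = ρ (Θ x))
    (hα1 : Valued.v α ≤ 1) (hα : Valued.v (α - ρ α) = 1) {d t : ℕ} (hD : IsRamifiedQuadraticDatum Θ ϖE d t) (hρϖ : ρ ϖE = ϖE)
    (hΘh : Θ h = h) (hh : h ≠ 0) {q : ℕ} (hq : Nat.card 𝓀[K] = q ^ 2)
    (hσres : ∀ z : K, ρ z = z → Valued.v z ≤ 1 → Valued.v (Θ z - z) < 1) (hram : Valued.v (α - Θ α) < 1)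
    (haniso : ¬ ∃ x : K, x ≠ 0 ∧ h * Θ x * x + ρ (h * Θ x * x) = 0)
    {lam : K} (hlam1 : Valued.v lam ≤ 1) {jl : ℕ} (hjl : Valued.v (lam - ρ lam) = Valued.v ϖE ^ jl * Valued.v (α - ρ α))
    {c : K} (hρc : ρ c = c) {a : ℕ} (hc : Valued.v c = Valued.v ϖE ^ a) (hlev : Valued.v (lam - 1) ≤ Valued.v c) (hajl : a ≤ jl)
    {c' : K} (hρc' : ρ c' = c') {b : ℕ} (hc' : Valued.v c' = Valued.v ϖE ^ b) (hlev2 : Valued.v ((lam - 1) * (lam - 1)) ≤ Valued.v c')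
    {n : ℕ} (hn : Valued.v (lam + ρ lam - 2) = Valued.v ϖE ^ n) (hb : b ≤ jl + n) {J : ℕ} (hJ : jl ≤ J) :
    ∑ j ∈ Finset.range (J + 1),
        (if IsOrd ρ α (ϖE ^ j) lam ∧ IsOrd ρ α (ϖE ^ j) (c⁻¹ * (lam - 1)) ∧ IsOrd ρ α (ϖE ^ j) (c'⁻¹ * ((lam - 1) * (lam - 1))) then
          (levelSet ρ Θ α ϖE h j 0).ncard else 0) =
      ∑ j ∈ Finset.range (min (jl - a) (jl + n - b) + 1), (if j = 0 then 1 else if j % 2 = 1 then 0 else if j + 2 ≤ 2 * d then q ^ (j / 2) else 0) := by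
  obtain ⟨hϖ0, hϖ1⟩ := ne_zero_and_v_lt_one_of_v_eq_exp_neg le_rfl hD.2.2.1
  rw [sum_ite_isOrd₃_eq_sum_range (map_ne_self_of_v_sub_map_eq_one hα) hϖ0 hϖ1 hlam1 hjl hρc hc hlev hajl hρc' hc' hlev2 hn hb hJ,
    sum_ncard_levelSet_zero_eq_ramK_aniso hρρ hvρ hΘρ hα1 hα hD hρϖ hΘh hh hq hσres hram haniso]

open scoped Classical in
/-- **(T5-P-axis) COMPOSED, TYPE U (M∕E and K♮∕F unramified), HYPERBOLIC SIDE**: `AX = Σ_{j ∈ range (J′+1)} row⁰_U,hyp(j)` (the a = 0 row of ★ `ncard_levelSet_unr_hyper_of_frame`).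
Package VERBATIM, then FILE 1's §1 tokens. [cite: Kottwitz1986BaseChangeUnits, §1 pp. 240–241] [cite: Flicker1998UnitaryFL, Prop. 7 p. 84] -/
theorem axis_lev_eq_sum_table_unr_hyper {d q : ℕ} [CompleteSpace K] [IsDiscreteValuationRing 𝒪[K]] [Finite 𝓀[K]]
    (hρρ : ∀ x, ρ (ρ x) = x) (hvρ : ∀ x, Valued.v (ρ x) = Valued.v x) (hΘΘ : ∀ x, Θ (Θ x) = x) (hΘρ : ∀ x, Θ (ρ x) = ρ (Θ x))
    (hvΘ : ∀ x, Valued.v (Θ x) = Valued.v x) (hα1 : Valued.v α ≤ 1) (hα : Valued.v (α - ρ α) = 1)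
    (hρϖE : ρ ϖE = ϖE) (hϖE : Valued.v ϖE = exp (-1 : ℤ)) (hq : Nat.card 𝓀[K] = q ^ 2)
    (hτα : Valued.v (ρ α - Θ α) < 1) (hd : 1 ≤ d) (hddE : Valued.v (ϖE - Θ ϖE) = Valued.v ϖE ^ d)
    (hfixE : ∀ z : K, ρ z = z → Θ z = z → z ≠ 0 → ∃ n : ℤ, Valued.v z = exp (2 * n))
    (hΘh : Θ h = h) (hh : h ≠ 0) (hhyper : ∃ x : K, x ≠ 0 ∧ h * Θ x * x + ρ (h * Θ x * x) = 0)
    {lam : K} (hlam1 : Valued.v lam ≤ 1) {jl : ℕ} (hjl : Valued.v (lam - ρ lam) = Valued.v ϖE ^ jl * Valued.v (α - ρ α))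
    {c : K} (hρc : ρ c = c) {a : ℕ} (hc : Valued.v c = Valued.v ϖE ^ a) (hlev : Valued.v (lam - 1) ≤ Valued.v c) (hajl : a ≤ jl)
    {c' : K} (hρc' : ρ c' = c') {b : ℕ} (hc' : Valued.v c' = Valued.v ϖE ^ b) (hlev2 : Valued.v ((lam - 1) * (lam - 1)) ≤ Valued.v c')
    {n : ℕ} (hn : Valued.v (lam + ρ lam - 2) = Valued.v ϖE ^ n) (hb : b ≤ jl + n) {J : ℕ} (hJ : jl ≤ J) :
    ∑ j ∈ Finset.range (J + 1),
        (if IsOrd ρ α (ϖE ^ j) lam ∧ IsOrd ρ α (ϖE ^ j) (c⁻¹ * (lam - 1)) ∧ IsOrd ρ α (ϖE ^ j) (c'⁻¹ * ((lam - 1) * (lam - 1))) then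
          (levelSet ρ Θ α ϖE h j 0).ncard else 0) =
      ∑ j ∈ Finset.range (min (jl - a) (jl + n - b) + 1),
        (if (j + d) % 2 = 0 then (if d ≤ j then (q + 1) * q ^ ((j + d) / 2 - 1) else (if j = 0 then 1 else (q + 1) * q ^ (j - 1))) else 0) := by
  obtain ⟨hϖ0, hϖ1⟩ := ne_zero_and_v_lt_one_of_v_eq_exp_neg le_rfl hϖE
  rw [sum_ite_isOrd₃_eq_sum_range (map_ne_self_of_v_sub_map_eq_one hα) hϖ0 hϖ1 hlam1 hjl hρc hc hlev hajl hρc' hc' hlev2 hn hb hJ,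
    sum_ncard_levelSet_zero_eq_unr_hyper hρρ hvρ hΘΘ hΘρ hvΘ hα1 hα hρϖE hϖE hq hτα hd hddE hfixE hΘh hh hhyper]

open scoped Classical in
/-- **(T5-P-axis) COMPOSED, TYPE U, ANISOTROPIC SIDE**: `AX = Σ_{j ∈ range (J′+1)} row⁰_U,an(j)` (the a = 0 row of ★ `ncard_levelSet_unr_aniso_of_frame`).
Package VERBATIM, then FILE 1's §1 tokens. [cite: Kottwitz1986BaseChangeUnits, §1 pp. 240–241] [cite: Flicker1998UnitaryFL, Prop. 7 p. 84] -/
theorem axis_lev_eq_sum_table_unr_aniso {d q : ℕ} [CompleteSpace K] [IsDiscreteValuationRing 𝒪[K]] [Finite 𝓀[K]]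
    (hρρ : ∀ x, ρ (ρ x) = x) (hvρ : ∀ x, Valued.v (ρ x) = Valued.v x) (hΘΘ : ∀ x, Θ (Θ x) = x) (hΘρ : ∀ x, Θ (ρ x) = ρ (Θ x))
    (hvΘ : ∀ x, Valued.v (Θ x) = Valued.v x) (hα1 : Valued.v α ≤ 1) (hα : Valued.v (α - ρ α) = 1)
    (hρϖE : ρ ϖE = ϖE) (hϖE : Valued.v ϖE = exp (-1 : ℤ)) (hq : Nat.card 𝓀[K] = q ^ 2)
    (hτα : Valued.v (ρ α - Θ α) < 1) (hd : 1 ≤ d) (hddE : Valued.v (ϖE - Θ ϖE) = Valued.v ϖE ^ d)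
    (hfixE : ∀ z : K, ρ z = z → Θ z = z → z ≠ 0 → ∃ n : ℤ, Valued.v z = exp (2 * n))
    (hΘh : Θ h = h) (hh : h ≠ 0) (haniso : ¬ ∃ x : K, x ≠ 0 ∧ h * Θ x * x + ρ (h * Θ x * x) = 0)
    {lam : K} (hlam1 : Valued.v lam ≤ 1) {jl : ℕ} (hjl : Valued.v (lam - ρ lam) = Valued.v ϖE ^ jl * Valued.v (α - ρ α))
    {c : K} (hρc : ρ c = c) {a : ℕ} (hc : Valued.v c = Valued.v ϖE ^ a) (hlev : Valued.v (lam - 1) ≤ Valued.v c) (hajl : a ≤ jl)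
    {c' : K} (hρc' : ρ c' = c') {b : ℕ} (hc' : Valued.v c' = Valued.v ϖE ^ b) (hlev2 : Valued.v ((lam - 1) * (lam - 1)) ≤ Valued.v c')
    {n : ℕ} (hn : Valued.v (lam + ρ lam - 2) = Valued.v ϖE ^ n) (hb : b ≤ jl + n) {J : ℕ} (hJ : jl ≤ J) :
    ∑ j ∈ Finset.range (J + 1),
        (if IsOrd ρ α (ϖE ^ j) lam ∧ IsOrd ρ α (ϖE ^ j) (c⁻¹ * (lam - 1)) ∧ IsOrd ρ α (ϖE ^ j) (c'⁻¹ * ((lam - 1) * (lam - 1))) then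
          (levelSet ρ Θ α ϖE h j 0).ncard else 0) =
      ∑ j ∈ Finset.range (min (jl - a) (jl + n - b) + 1),
        (if d = j + 1 ∨ (j + 1 < d ∧ (j + d) % 2 = 1) then (if j = 0 then 1 else (q + 1) * q ^ (j - 1)) else 0) := by
  obtain ⟨hϖ0, hϖ1⟩ := ne_zero_and_v_lt_one_of_v_eq_exp_neg le_rfl hϖE
  rw [sum_ite_isOrd₃_eq_sum_range (map_ne_self_of_v_sub_map_eq_one hα) hϖ0 hϖ1 hlam1 hjl hρc hc hlev hajl hρc' hc' hlev2 hn hb hJ,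
    sum_ncard_levelSet_zero_eq_unr_aniso hρρ hvρ hΘΘ hΘρ hvΘ hα1 hα hρϖE hϖE hq hτα hd hddE hfixE hΘh hh haniso]

open scoped Classical in
/-- **(T5-P-axis) COMPOSED, TYPE RamM, `hnP` SIDE**: `AX = Σ_{j ∈ range (J′+1)} row⁰_RamM,P(j)` (the a = 0 row of ★ `ncard_levelSet_eq_hnP`, LH4-p04 (g5)).  Package VERBATIM
(ramified datum `(ρ, α, d_ρ)`, `|ϖE| = exp(−2)`), then FILE 1's §1 tokens; `ρα ≠ α` by ★ `map_ne_self_of_datum`. [cite: Kottwitz1986BaseChangeUnits, §1 pp. 240–241] [cite: Flicker1998UnitaryFL, Prop. 7 p. 84] [cite: Serre1979, Ch. V §3] -/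
theorem axis_lev_eq_sum_table_ramM_hnP {dρ t : ℕ} {K' : Type*} [Field K'] [Valued K' ℤᵐ⁰] {σ' : K' →+* K'} {π' : K'} {d' : ℕ} [CompleteSpace K] [IsDiscreteValuationRing 𝒪[K]] [Finite 𝓀[K]] [IsDiscreteValuationRing 𝒪[K']] [Finite 𝓀[K']]
    (hD : IsRamifiedQuadraticDatum ρ α dρ t) (hΘρ : ∀ x, Θ (ρ x) = ρ (Θ x)) (hvΘ : ∀ x, Valued.v (Θ x) = Valued.v x)
    (hϖE : Valued.v ϖE = exp (-2 : ℤ)) (hρϖ : ρ ϖE = ϖE) {q : ℕ} (hq : Nat.card 𝓀[K] = q) (hq' : Nat.card 𝓀[K'] = q) (hq2 : 2 ∣ q)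
    (hσ' : ∀ x, σ' (σ' x) = x) (hvσ' : ∀ x, Valued.v (σ' x) = Valued.v x) (hfix' : ∀ x : K', σ' x = x → x ≠ 0 → ∃ n : ℤ, Valued.v x = exp (2 * n))
    (hπ' : Valued.v π' = exp (-1 : ℤ)) (hdd' : Valued.v (π' - σ' π') = Valued.v π' ^ d')
    (jK : K' →+* K) (hjle : ∀ x y : K', Valued.v (jK x) ≤ Valued.v (jK y) ↔ Valued.v x ≤ Valued.v y) (hjΘ : ∀ x, Θ (jK x) = jK x)
    (hjfix : ∀ z : K, Θ z = z → ∃ x, jK x = z) (hjσ : ∀ x, jK (σ' x) = ρ (jK x)) (hjπ : Valued.v (jK π') = exp (-2 : ℤ))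
    {ϖ : K} {dΘ tΘ : ℕ} (hDΘ : IsRamifiedQuadraticDatum Θ ϖ dΘ tΘ)
    (hFN : ∀ f : K, ρ f = f → Θ f = f → Valued.v f = 1 → ∃ x : K, x * Θ x = f)
    (hΘh : Θ h = h) (hh : h ≠ 0) {vh : ℤ} (hvh : Valued.v h = exp (-vh)) {e : ℤ} (he : vh + dρ = 2 * e)
    {g s0 : ℕ} (hg : dΘ = 2 * g) (hds : 2 * d' = dρ + 2 * s0) (hs1 : 1 ≤ s0)
    (hcls0 : ∀ k₀ : ℤ, Valued.v (1 + ρ h / h * (ρ (α ^ k₀ * Θ (α ^ k₀)) / (α ^ k₀ * Θ (α ^ k₀)))) ≤ exp (-(2 * (d' : ℤ) - 2)))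
    (hclsT : ∀ k₀ : ℤ, (∃ r : ℤ, k₀ + s0 + e = 2 * r) → ∃ ω₀ : Kˣ, Valued.v (ω₀ : K) = 1 ∧
      ρ h / h * (ρ (α ^ k₀ * Θ (α ^ k₀)) / (α ^ k₀ * Θ (α ^ k₀))) * (ρ ((ω₀ : K) * Θ ω₀) / ((ω₀ : K) * Θ ω₀)) = -1)
    (hclsO : ∀ k₀ : ℤ, (∃ r : ℤ, k₀ + s0 + e = 2 * r + 1) → ∀ ω : Kˣ, Valued.v (ω : K) = 1 →
      ¬ Valued.v (1 + ρ h / h * (ρ (α ^ k₀ * Θ (α ^ k₀)) / (α ^ k₀ * Θ (α ^ k₀))) * (ρ ((ω : K) * Θ ω) / ((ω : K) * Θ ω))) ≤ exp (-(2 * (d' : ℤ))))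
    {lam : K} (hlam1 : Valued.v lam ≤ 1) {jl : ℕ} (hjl : Valued.v (lam - ρ lam) = Valued.v ϖE ^ jl * Valued.v (α - ρ α))
    {c : K} (hρc : ρ c = c) {a : ℕ} (hc : Valued.v c = Valued.v ϖE ^ a) (hlev : Valued.v (lam - 1) ≤ Valued.v c) (hajl : a ≤ jl)
    {c' : K} (hρc' : ρ c' = c') {b : ℕ} (hc' : Valued.v c' = Valued.v ϖE ^ b) (hlev2 : Valued.v ((lam - 1) * (lam - 1)) ≤ Valued.v c')
    {n : ℕ} (hn : Valued.v (lam + ρ lam - 2) = Valued.v ϖE ^ n) (hb : b ≤ jl + n) {J : ℕ} (hJ : jl ≤ J) :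
    ∑ j ∈ Finset.range (J + 1),
        (if IsOrd ρ α (ϖE ^ j) lam ∧ IsOrd ρ α (ϖE ^ j) (c⁻¹ * (lam - 1)) ∧ IsOrd ρ α (ϖE ^ j) (c'⁻¹ * ((lam - 1) * (lam - 1))) then
          (levelSet ρ Θ α ϖE h j 0).ncard else 0) =
      ∑ j ∈ Finset.range (min (jl - a) (jl + n - b) + 1),
        (if j = 0 then 1 else if j + 1 = s0 then q ^ j else if j + 1 < s0 then q ^ j else if (j - s0) % 2 = 1 then 0 else (if 2 * g ≤ j - s0 then 2 else 1) * q ^ (j - (j - s0) / 2)) := by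
  obtain ⟨hϖ0, hϖ1⟩ := ne_zero_and_v_lt_one_of_v_eq_exp_neg (by norm_num) hϖE
  rw [sum_ite_isOrd₃_eq_sum_range (map_ne_self_of_datum hD) hϖ0 hϖ1 hlam1 hjl hρc hc hlev hajl hρc' hc' hlev2 hn hb hJ,
    sum_ncard_levelSet_zero_eq_ramM_hnP hD hΘρ hvΘ hϖE hρϖ hq hq' hq2 hσ' hvσ' hfix' hπ' hdd' jK hjle hjΘ hjfix hjσ hjπ hDΘ hFN hΘh hh hvh he hg hds hs1
      hcls0 hclsT hclsO]

open scoped Classical in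
/-- **(T5-P-axis) COMPOSED, TYPE RamM, `hnM` SIDE**: `AX = Σ_{j ∈ range (J′+1)} row⁰_RamM,M(j)` (the a = 0 row of ★ `ncard_levelSet_eq_hnM`).  Package VERBATIM, then FILE 1's §1
tokens. [cite: Kottwitz1986BaseChangeUnits, §1 pp. 240–241] [cite: Flicker1998UnitaryFL, Prop. 7 p. 84] [cite: Serre1979, Ch. V §3] -/
theorem axis_lev_eq_sum_table_ramM_hnM {dρ t : ℕ} {K' : Type*} [Field K'] [Valued K' ℤᵐ⁰] {σ' : K' →+* K'} {π' : K'} {d' : ℕ} [CompleteSpace K] [IsDiscreteValuationRing 𝒪[K]] [Finite 𝓀[K]] [IsDiscreteValuationRing 𝒪[K']] [Finite 𝓀[K']]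
    (hD : IsRamifiedQuadraticDatum ρ α dρ t) (hΘρ : ∀ x, Θ (ρ x) = ρ (Θ x)) (hvΘ : ∀ x, Valued.v (Θ x) = Valued.v x)
    (hϖE : Valued.v ϖE = exp (-2 : ℤ)) (hρϖ : ρ ϖE = ϖE) {q : ℕ} (hq : Nat.card 𝓀[K] = q) (hq' : Nat.card 𝓀[K'] = q)
    (hσ' : ∀ x, σ' (σ' x) = x) (hvσ' : ∀ x, Valued.v (σ' x) = Valued.v x) (hfix' : ∀ x : K', σ' x = x → x ≠ 0 → ∃ n : ℤ, Valued.v x = exp (2 * n))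
    (hπ' : Valued.v π' = exp (-1 : ℤ)) (hdd' : Valued.v (π' - σ' π') = Valued.v π' ^ d')
    (jK : K' →+* K) (hjle : ∀ x y : K', Valued.v (jK x) ≤ Valued.v (jK y) ↔ Valued.v x ≤ Valued.v y) (hjΘ : ∀ x, Θ (jK x) = jK x)
    (hjfix : ∀ z : K, Θ z = z → ∃ x, jK x = z) (hjσ : ∀ x, jK (σ' x) = ρ (jK x)) (hjπ : Valued.v (jK π') = exp (-2 : ℤ))
    {ϖ : K} {dΘ tΘ : ℕ} (hDΘ : IsRamifiedQuadraticDatum Θ ϖ dΘ tΘ)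
    (hFN : ∀ f : K, ρ f = f → Θ f = f → Valued.v f = 1 → ∃ x : K, x * Θ x = f)
    {n₀ : K} (hΘn₀ : Θ n₀ = n₀) (hn₀1 : Valued.v n₀ = 1) (hn₀N : ¬ ∃ z : K, z * Θ z = n₀)
    (hΘh : Θ h = h) (hh : h ≠ 0) {vh : ℤ} (hvh : Valued.v h = exp (-vh)) {e : ℤ} (he : vh + dρ = 2 * e)
    {g s0 : ℕ} (hg : dΘ = 2 * g) (hds : 2 * d' = dρ + 2 * s0) (hs1 : 1 ≤ s0)
    (hcls0 : ∀ k₀ : ℤ, Valued.v (1 + ρ h / h * (ρ (α ^ k₀ * Θ (α ^ k₀)) / (α ^ k₀ * Θ (α ^ k₀)))) ≤ exp (-(2 * (d' : ℤ) - 2)))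
    (hclsE : ∀ k₀ : ℤ, (∃ r : ℤ, k₀ + s0 + e = 2 * r) → ∃ ω₀ : Kˣ, Valued.v (ω₀ : K) = 1 ∧
      ρ h / h * (ρ (α ^ k₀ * Θ (α ^ k₀)) / (α ^ k₀ * Θ (α ^ k₀))) * (ρ ((ω₀ : K) * Θ ω₀) / ((ω₀ : K) * Θ ω₀)) * (ρ n₀ / n₀) = -1)
    (hclsO : ∀ k₀ : ℤ, (∃ r : ℤ, k₀ + s0 + e = 2 * r + 1) → ∀ ω : Kˣ, Valued.v (ω : K) = 1 →
      ¬ Valued.v (1 + ρ h / h * (ρ (α ^ k₀ * Θ (α ^ k₀)) / (α ^ k₀ * Θ (α ^ k₀))) * (ρ ((ω : K) * Θ ω) / ((ω : K) * Θ ω))) ≤ exp (-(2 * (d' : ℤ))))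
    {lam : K} (hlam1 : Valued.v lam ≤ 1) {jl : ℕ} (hjl : Valued.v (lam - ρ lam) = Valued.v ϖE ^ jl * Valued.v (α - ρ α))
    {c : K} (hρc : ρ c = c) {a : ℕ} (hc : Valued.v c = Valued.v ϖE ^ a) (hlev : Valued.v (lam - 1) ≤ Valued.v c) (hajl : a ≤ jl)
    {c' : K} (hρc' : ρ c' = c') {b : ℕ} (hc' : Valued.v c' = Valued.v ϖE ^ b) (hlev2 : Valued.v ((lam - 1) * (lam - 1)) ≤ Valued.v c')
    {n : ℕ} (hn : Valued.v (lam + ρ lam - 2) = Valued.v ϖE ^ n) (hb : b ≤ jl + n) {J : ℕ} (hJ : jl ≤ J) :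
    ∑ j ∈ Finset.range (J + 1),
        (if IsOrd ρ α (ϖE ^ j) lam ∧ IsOrd ρ α (ϖE ^ j) (c⁻¹ * (lam - 1)) ∧ IsOrd ρ α (ϖE ^ j) (c'⁻¹ * ((lam - 1) * (lam - 1))) then
          (levelSet ρ Θ α ϖE h j 0).ncard else 0) =
      ∑ j ∈ Finset.range (min (jl - a) (jl + n - b) + 1),
        (if j = 0 then 1 else if j + 1 = s0 then q ^ j else if j + 1 < s0 then q ^ j else if (j - s0) % 2 = 1 then 0 else if j - s0 + 2 ≤ 2 * g then q ^ (j - (j - s0) / 2) else 0) := by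
  obtain ⟨hϖ0, hϖ1⟩ := ne_zero_and_v_lt_one_of_v_eq_exp_neg (by norm_num) hϖE
  rw [sum_ite_isOrd₃_eq_sum_range (map_ne_self_of_datum hD) hϖ0 hϖ1 hlam1 hjl hρc hc hlev hajl hρc' hc' hlev2 hn hb hJ,
    sum_ncard_levelSet_zero_eq_ramM_hnM hD hΘρ hvΘ hϖE hρϖ hq hq' hσ' hvσ' hfix' hπ' hdd' jK hjle hjΘ hjfix hjσ hjπ hDΘ hFN hΘn₀ hn₀1 hn₀N hΘh hh hvh he hg hds hs1
      hcls0 hclsE hclsO]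

/-! ## §2 Type RamK in closed form (§1 ∘ §0): doubled levels, the cut, and the side-free ball count below the threshold -/

open scoped Classical in
/-- **(T5-P-axis) TYPE RamK IN CLOSED FORM, HYPERBOLIC SIDE**: `AX = Σ_{i ∈ range (J′∕2+1)} q^i + Σ_{i ∈ Ico d (J′∕2+1)} q^i` (`J′ = min(jλ − a, jλ + n − b)`; `d ≥ 1` is a
clause of the datum): the root-ray ball of radius `J′∕2`, the levels `i ≥ d` doubled. [cite: Kottwitz1986BaseChangeUnits, §1 pp. 240–241] [cite: Flicker1998UnitaryFL, Prop. 7 p. 84]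
[cite: Serre1980Trees, Ch. II §1.1] -/
theorem axis_lev_eq_geom_ramK_hyper [CompleteSpace K] [IsDiscreteValuationRing 𝒪[K]] [Finite 𝓀[K]]
    (hρρ : ∀ x, ρ (ρ x) = x) (hvρ : ∀ x, Valued.v (ρ x) = Valued.v x) (hΘρ : ∀ x, Θ (ρ x) = ρ (Θ x))
    (hα1 : Valued.v α ≤ 1) (hα : Valued.v (α - ρ α) = 1) {d t : ℕ} (hD : IsRamifiedQuadraticDatum Θ ϖE d t) (hρϖ : ρ ϖE = ϖE)
    (hΘh : Θ h = h) (hh : h ≠ 0) {q : ℕ} (hq : Nat.card 𝓀[K] = q ^ 2)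
    (hσres : ∀ z : K, ρ z = z → Valued.v z ≤ 1 → Valued.v (Θ z - z) < 1) (hram : Valued.v (α - Θ α) < 1)
    (hhyper : ∃ x : K, x ≠ 0 ∧ h * Θ x * x + ρ (h * Θ x * x) = 0)
    {lam : K} (hlam1 : Valued.v lam ≤ 1) {jl : ℕ} (hjl : Valued.v (lam - ρ lam) = Valued.v ϖE ^ jl * Valued.v (α - ρ α))
    {c : K} (hρc : ρ c = c) {a : ℕ} (hc : Valued.v c = Valued.v ϖE ^ a) (hlev : Valued.v (lam - 1) ≤ Valued.v c) (hajl : a ≤ jl)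
    {c' : K} (hρc' : ρ c' = c') {b : ℕ} (hc' : Valued.v c' = Valued.v ϖE ^ b) (hlev2 : Valued.v ((lam - 1) * (lam - 1)) ≤ Valued.v c')
    {n : ℕ} (hn : Valued.v (lam + ρ lam - 2) = Valued.v ϖE ^ n) (hb : b ≤ jl + n) {J : ℕ} (hJ : jl ≤ J) :
    ∑ j ∈ Finset.range (J + 1),
        (if IsOrd ρ α (ϖE ^ j) lam ∧ IsOrd ρ α (ϖE ^ j) (c⁻¹ * (lam - 1)) ∧ IsOrd ρ α (ϖE ^ j) (c'⁻¹ * ((lam - 1) * (lam - 1))) then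
          (levelSet ρ Θ α ϖE h j 0).ncard else 0) =
      ∑ i ∈ Finset.range (min (jl - a) (jl + n - b) / 2 + 1), q ^ i + ∑ i ∈ Finset.Ico d (min (jl - a) (jl + n - b) / 2 + 1), q ^ i := by
  rw [axis_lev_eq_sum_table_ramK_hyper hρρ hvρ hΘρ hα1 hα hD hρϖ hΘh hh hq hσres hram hhyper hlam1 hjl hρc hc hlev hajl hρc' hc' hlev2 hn hb hJ,
    sum_ramK_hyper_rowZero_eq q _ hD.2.2.2.2.2.1]

open scoped Classical in
/-- **(T5-P-axis) TYPE RamK IN CLOSED FORM, ANISOTROPIC SIDE**: `AX = Σ_{i ∈ range (min (J′∕2+1) d)} q^i` — the root-ray ball cut at level `d − 1`.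
[cite: Kottwitz1986BaseChangeUnits, §1 pp. 240–241] [cite: Flicker1998UnitaryFL, Prop. 7 p. 84] [cite: Serre1980Trees, Ch. II §1.1] -/
theorem axis_lev_eq_geom_ramK_aniso [CompleteSpace K] [IsDiscreteValuationRing 𝒪[K]] [Finite 𝓀[K]]
    (hρρ : ∀ x, ρ (ρ x) = x) (hvρ : ∀ x, Valued.v (ρ x) = Valued.v x) (hΘρ : ∀ x, Θ (ρ x) = ρ (Θ x))
    (hα1 : Valued.v α ≤ 1) (hα : Valued.v (α - ρ α) = 1) {d t : ℕ} (hD : IsRamifiedQuadraticDatum Θ ϖE d t) (hρϖ : ρ ϖE = ϖE)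
    (hΘh : Θ h = h) (hh : h ≠ 0) {q : ℕ} (hq : Nat.card 𝓀[K] = q ^ 2)
    (hσres : ∀ z : K, ρ z = z → Valued.v z ≤ 1 → Valued.v (Θ z - z) < 1) (hram : Valued.v (α - Θ α) < 1)
    (haniso : ¬ ∃ x : K, x ≠ 0 ∧ h * Θ x * x + ρ (h * Θ x * x) = 0)
    {lam : K} (hlam1 : Valued.v lam ≤ 1) {jl : ℕ} (hjl : Valued.v (lam - ρ lam) = Valued.v ϖE ^ jl * Valued.v (α - ρ α))
    {c : K} (hρc : ρ c = c) {a : ℕ} (hc : Valued.v c = Valued.v ϖE ^ a) (hlev : Valued.v (lam - 1) ≤ Valued.v c) (hajl : a ≤ jl)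
    {c' : K} (hρc' : ρ c' = c') {b : ℕ} (hc' : Valued.v c' = Valued.v ϖE ^ b) (hlev2 : Valued.v ((lam - 1) * (lam - 1)) ≤ Valued.v c')
    {n : ℕ} (hn : Valued.v (lam + ρ lam - 2) = Valued.v ϖE ^ n) (hb : b ≤ jl + n) {J : ℕ} (hJ : jl ≤ J) :
    ∑ j ∈ Finset.range (J + 1),
        (if IsOrd ρ α (ϖE ^ j) lam ∧ IsOrd ρ α (ϖE ^ j) (c⁻¹ * (lam - 1)) ∧ IsOrd ρ α (ϖE ^ j) (c'⁻¹ * ((lam - 1) * (lam - 1))) then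
          (levelSet ρ Θ α ϖE h j 0).ncard else 0) =
      ∑ i ∈ Finset.range (min (min (jl - a) (jl + n - b) / 2 + 1) d), q ^ i := by
  rw [axis_lev_eq_sum_table_ramK_aniso hρρ hvρ hΘρ hα1 hα hD hρϖ hΘh hh hq hσres hram haniso hlam1 hjl hρc hc hlev hajl hρc' hc' hlev2 hn hb hJ,
    sum_ramK_aniso_rowZero_eq q _ hD.2.2.2.2.2.1]

open scoped Classical in
/-- **(T5-P-axis) TYPE RamK BELOW THE THRESHOLD `J′ + 2 ≤ 2d`, SIDE-FREE**: `AX = Σ_{i ∈ range (J′∕2+1)} q^i` WHATEVER the hermitian scalar `h` (hyperbolic or anisotropic —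
no `hhyper`∕`haniso` letter): near enough to `1` (`J′ = min(jλ − a, jλ + n − b)` small against `2d − 2`) the `lev_{a,m}` axis is the plain ball count `1 + q + ⋯ + q^{J′∕2}`.
[cite: Kottwitz1986BaseChangeUnits, §1 pp. 240–241] [cite: Flicker1998UnitaryFL, Prop. 7 p. 84] [cite: Serre1980Trees, Ch. II §1.1] -/
theorem axis_lev_eq_geom_ramK_of_le [CompleteSpace K] [IsDiscreteValuationRing 𝒪[K]] [Finite 𝓀[K]]
    (hρρ : ∀ x, ρ (ρ x) = x) (hvρ : ∀ x, Valued.v (ρ x) = Valued.v x) (hΘρ : ∀ x, Θ (ρ x) = ρ (Θ x))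
    (hα1 : Valued.v α ≤ 1) (hα : Valued.v (α - ρ α) = 1) {d t : ℕ} (hD : IsRamifiedQuadraticDatum Θ ϖE d t) (hρϖ : ρ ϖE = ϖE)
    (hΘh : Θ h = h) (hh : h ≠ 0) {q : ℕ} (hq : Nat.card 𝓀[K] = q ^ 2)
    (hσres : ∀ z : K, ρ z = z → Valued.v z ≤ 1 → Valued.v (Θ z - z) < 1) (hram : Valued.v (α - Θ α) < 1)
    {lam : K} (hlam1 : Valued.v lam ≤ 1) {jl : ℕ} (hjl : Valued.v (lam - ρ lam) = Valued.v ϖE ^ jl * Valued.v (α - ρ α))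
    {c : K} (hρc : ρ c = c) {a : ℕ} (hc : Valued.v c = Valued.v ϖE ^ a) (hlev : Valued.v (lam - 1) ≤ Valued.v c) (hajl : a ≤ jl)
    {c' : K} (hρc' : ρ c' = c') {b : ℕ} (hc' : Valued.v c' = Valued.v ϖE ^ b) (hlev2 : Valued.v ((lam - 1) * (lam - 1)) ≤ Valued.v c')
    {n : ℕ} (hn : Valued.v (lam + ρ lam - 2) = Valued.v ϖE ^ n) (hb : b ≤ jl + n) {J : ℕ} (hJ : jl ≤ J)
    (hJd : min (jl - a) (jl + n - b) + 2 ≤ 2 * d) :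
    ∑ j ∈ Finset.range (J + 1),
        (if IsOrd ρ α (ϖE ^ j) lam ∧ IsOrd ρ α (ϖE ^ j) (c⁻¹ * (lam - 1)) ∧ IsOrd ρ α (ϖE ^ j) (c'⁻¹ * ((lam - 1) * (lam - 1))) then
          (levelSet ρ Θ α ϖE h j 0).ncard else 0) =
      ∑ i ∈ Finset.range (min (jl - a) (jl + n - b) / 2 + 1), q ^ i := by
  by_cases hside : ∃ x : K, x ≠ 0 ∧ h * Θ x * x + ρ (h * Θ x * x) = 0
  · rw [axis_lev_eq_sum_table_ramK_hyper hρρ hvρ hΘρ hα1 hα hD hρϖ hΘh hh hq hσres hram hside hlam1 hjl hρc hc hlev hajl hρc' hc' hlev2 hn hb hJ,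
      sum_ramK_hyper_rowZero_eq_of_le q _ hJd]
  · rw [axis_lev_eq_sum_table_ramK_aniso hρρ hvρ hΘρ hα1 hα hD hρϖ hΘh hh hq hσres hram hside hlam1 hjl hρc hc hlev hajl hρc' hc' hlev2 hn hb hJ,
      sum_ramK_aniso_rowZero_eq_of_le q _ hJd]

end Summit.HodgeConjecture.HodgeConjecture.Cruxes.H413.F0P3cDyRamJointProfileCensusAxisClosedForm
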